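import Summits.ResolutionOfSingularities.ResolutionOfSingularities.Theorems.EquisingularLiftEquisingularLiftNatTowerReachSsDefs
import Summits.ResolutionOfSingularities.ResolutionOfSingularities.Theorems.EquisingularLiftEquisingularLiftNatDirZeroDefs
import HarnessLib

/-!
# [OURS · L1 W4.5(b) · EL♮ / EL♮(3)] RESIDUE HYPOTHESIS DEFS 5 — the NOSE cut's named hypotheses (NOSE WORD v1.1 (N0)): `ReachPtNoseBTriplePrime`,
# `NoseHypUnobsBTriplePrime` (H-ν1), `NoseHypPointsFirstBTriplePrime` (H-ν2)

Typed by res-type-027 g20 on the W4.5b desk's DEAL (RULING R33/R35, 2026-08-28T16:17:40Z: «027 g20 = TYPE (N0) of NOSE WORD v1.1 3cdc419e1f6dc846: the two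
hypothesis defs in the shapes (H-ν1)/(H-ν2) VERBATIM (definition lane), names confirmed by res-L1-w45b-nose-w2 (pen of the NOSE WORD) + the text owner
res-L1-w45b-lead-2 first»).  House style R21″ (C): each widening = its defs in a successor `…NatResidueHypDefs<k>` (p617887 / p620821 / p625534 / p628770 / p634892
never edited); definitions only — no lemma, no `sorry`, no instance, no notation; standard axioms.  OURS; NAMED HYPOTHESES (abbreviations of statement fragments of
OUR equisingular-lift route), not statements of any manuscript; nothing of [Hironaka2017] is asserted; AI-written, weaker than expert review; resolution in positive
characteristic is NOT proved here.  `--kind definition --supports stmt-ResolutionOfSingularities-20148 --as helper`.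

SHAPES (NOSE WORD v1.1 `Cruxes/EquisingularLiftNatThree/NOSE-WORD-v1.md` §1, VERBATIM):
* `ReachPtNoseBTriplePrime F₁ F₂ υ x T₂ F₉ β T₉` — K5′'s `Reach` slot (`target_elnat_of_subchainResolution'`, …NatSubchainPointResolutionOff:63) instantiated by THE NOSE
  MOVE ONE FLOOR UP: a closed infinite `Z ⊆ T₂`, `T₂ ⊄ Z`, with the curve clause, `Z̃ := redSub F₂ Z hZ` REGULAR and with UNOBSTRUCTED embedded deformations in the stage
  (`DirStepUnobs F₂ univ _ Z hZ`, …NatDirZeroDefs:64 — Čech `H¹(Z̃, 𝒩_{Z̃/F₂}) = 0`) and the ambient REGULAR ALONG `Z̃` (the two regularity clauses in the verbatim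
  form of the (T-k) fact `EmbeddedCurveLiftAt`), its blow-up `υ'`, then a B‴ chain (`TowerPtRegB₄` / `TowerPtRamB₄` / `TowerRoundBTriplePrime`, seed lists `[]`/`[]`,
  `K = ∅`) reaching `(F₉, γ', T₉)` with `β = γ' ≫ υ'`.  The point-step binders `υ`, `x` are unreferenced (K5′ supplies the step context).  TEXT = the pen's
  EXACT def text `L/res-L1-w45b-nose-w2/N0-NoseHypDefs5.sig.lean.txt` sha16 7e8c8bbbb4cc9ed7 (1), token for token (kernel-checked by res-L1-w45b-nose-w2 against
  his (N4) glue `NosePointsFirstHSUB.lean` baa6730fbcc4f5bf).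
* (H-ν1) `NoseHypUnobsBTriplePrime k n H ι` — `ReachNoseTowerBTriplePrime` (…NatTowerReachSsDefs:110, p628165 lineage) VERBATIM with the head conjunct
  `IsLiftableNoseClass₂ k n Z ∧` REPLACED IN PLACE by the pen's three conjuncts (sig file (3)): `Z̃` regular (pointwise) ∧ ambient regular along `Z̃` ((T-k) form) ∧
  `DirStepUnobs ℙⁿ_k univ _ Z hZ`; everything else verbatim (zero-length point prefix).  OPTIONAL for the 36th (its rung (R-ν1) is not yet written); typed here
  because the desk's deal names both hypotheses.
* (H-ν2) `NoseHypPointsFirstBTriplePrime k n H ι` — blob #20 `IsoHypDefTowerBTriplePrime` (…NatResidueHypDefs3, p628770) = K5′'s `hres` block VERBATIM with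
  `ReachTowerBTriplePrime ↦ ReachPtNoseBTriplePrime` (one token; the point-step clause is the first conjunct of the point-resolution motive's closure, the nose move
  hangs off the LAST point step) = sig file (2) token for token.
Rungs (R-ν1)/(R-ν2) and the 36th/37th registration are NOT in this file (NOSE WORD §2; desk R35).
-/

set_option linter.dupNamespace false
noncomputable section
open CategoryTheory CategoryTheory.Limits AlgebraicGeometry TopologicalSpace Topology IsLocalRing
open Literature.AlgebraicGeometry.Resolution
open AlgebraicGeometry.Scheme.IdealSheafData
namespace Summit.ResolutionOfSingularities.ResolutionOfSingularities.Cruxes.EquisingularLiftNat.Sections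

/-- **`ReachPtNoseBTriplePrime`** — (H-ν2)'s `Reach` slot: THE NOSE MOVE ONE FLOOR UP, hung off the point step `(F₁, x, υ, T₂)` (the binders `_υ`, `_x` are K5′'s step
context and are not read by the move): a closed infinite curve `Z ⊆ T₂`, `T₂ ⊄ Z`, `Z̃` regular, the ambient regular along `Z̃`, `H¹(Z̃, 𝒩_{Z̃/F₂}) = 0` (Čech), its
blow-up, then a B‴ chain.  The pen's sig file 7e8c8bbbb4cc9ed7 (1) token for token.  [OURS · L1 W4.5b · named hypothesis fragment, no mathematical content of its own] -/
def ReachPtNoseBTriplePrime (F₁ F₂ : Scheme.{0}) (_υ : F₂ ⟶ F₁) (_x : F₁) (T₂ : Set F₂) (F₉ : Scheme.{0}) (β : F₉ ⟶ F₂) (T₉ : Set F₉) : Prop :=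
  ∃ (Z : Set F₂) (hZ : IsClosed Z),
    Z ⊆ T₂ ∧ ¬ (T₂ ⊆ Z) ∧ Z.Infinite ∧
    (∀ z : ↥(redSub F₂ Z hZ), IsClosed ({z} : Set ↥(redSub F₂ Z hZ)) → ringKrullDim ((redSub F₂ Z hZ).presheaf.stalk z) = ((1 : ℕ) : WithBot ℕ∞)) ∧
    (∀ x : redSub F₂ Z hZ, IsRegularLocalRing ((redSub F₂ Z hZ).presheaf.stalk x)) ∧
    (∀ (i : redSub F₂ Z hZ ⟶ redSub F₂ Set.univ isClosed_univ), i ≫ redSubι F₂ Set.univ isClosed_univ = redSubι F₂ Z hZ →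
      ∀ x : redSub F₂ Z hZ, IsRegularLocalRing ((redSub F₂ Set.univ isClosed_univ).presheaf.stalk (i x))) ∧
    DirStepUnobs F₂ Set.univ isClosed_univ Z hZ ∧
    ∃ (F₃ : Scheme.{0}) (υ' : F₃ ⟶ F₂), IsBlowup υ' (vanishingIdeal (⟨Z, hZ⟩ : Closeds F₂)) ∧
      ∃ (γ' : F₉ ⟶ F₃) (E' : Set F₉) (Es' Ns' : List (Set F₉)) (K' : Set F₉),
        (∀ R : (∀ G : Scheme.{0}, (G ⟶ F₃) → Set G → Set G → List (Set G) → List (Set G) → Set G → Prop),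
          R F₃ (𝟙 F₃) (closure (υ' ⁻¹' (T₂ \ Z))) (υ' ⁻¹' Z) [] [] ∅ →
          TowerPtRegB₄ F₃ R → TowerPtRamB₄ F₃ R → TowerRoundBTriplePrime F₂ F₃ υ' Z hZ R →
          R F₉ γ' T₉ E' Es' Ns' K') ∧
        β = γ' ≫ υ'

/-- **(H-ν1) `NoseHypUnobsBTriplePrime`** — the B‴ NOSE AT THE INITIAL STAGE with the class₂ certificate replaced by the UNOBSTRUCTEDNESS certificate:
`ReachNoseTowerBTriplePrime k n H ι` (…NatTowerReachSsDefs) VERBATIM except that the head conjunct `IsLiftableNoseClass₂ k n Z` becomes «`Z̃` regular ∧ `ℙⁿ_k` regular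
along `Z̃` ∧ `DirStepUnobs ℙⁿ_k univ _ Z hZ`» (`H¹(Z̃, 𝒩_{Z̃/ℙⁿ}) = 0`, Čech form) — the pen's sig file 7e8c8bbbb4cc9ed7 (3).  Neither certificate implies the other
(NOSE WORD v1.1 §1/§4 (K-ν-5)); a registered residue would keep `¬ ReachNoseTowerBTriplePrime` beside the negation of this one.  Its rung (R-ν1) is not yet written
(OPTIONAL for the 36th).  [OURS · L1 W4.5b · named hypothesis, no mathematical content of its own] -/
def NoseHypUnobsBTriplePrime (k : Type) [Field k] (n : ℕ) (H : Scheme.{0})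
    (ι : H ⟶ (Literature.AlgebraicGeometry.Motives.projectiveSpace n k).left) : Prop :=
  ∃ (Z : Set (Literature.AlgebraicGeometry.Motives.projectiveSpace n k).left) (hZ : IsClosed Z),
    (∀ x : redSub (Literature.AlgebraicGeometry.Motives.projectiveSpace n k).left Z hZ, IsRegularLocalRing ((redSub (Literature.AlgebraicGeometry.Motives.projectiveSpace n k).left Z hZ).presheaf.stalk x)) ∧
    (∀ (i : redSub (Literature.AlgebraicGeometry.Motives.projectiveSpace n k).left Z hZ ⟶ redSub (Literature.AlgebraicGeometry.Motives.projectiveSpace n k).left Set.univ isClosed_univ), i ≫ redSubι (Literature.AlgebraicGeometry.Motives.projectiveSpace n k).left Set.univ isClosed_univ = redSubι (Literature.AlgebraicGeometry.Motives.projectiveSpace n k).left Z hZ →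
      ∀ x : redSub (Literature.AlgebraicGeometry.Motives.projectiveSpace n k).left Z hZ, IsRegularLocalRing ((redSub (Literature.AlgebraicGeometry.Motives.projectiveSpace n k).left Set.univ isClosed_univ).presheaf.stalk (i x))) ∧
    DirStepUnobs (Literature.AlgebraicGeometry.Motives.projectiveSpace n k).left Set.univ isClosed_univ Z hZ ∧
    Z ⊆ Set.range ι ∧ ¬ (Set.range ι ⊆ Z) ∧ Z.Infinite ∧
    (∀ z : ↥(redSub (Literature.AlgebraicGeometry.Motives.projectiveSpace n k).left Z hZ),
      IsClosed ({z} : Set ↥(redSub (Literature.AlgebraicGeometry.Motives.projectiveSpace n k).left Z hZ)) →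
        ringKrullDim ((redSub (Literature.AlgebraicGeometry.Motives.projectiveSpace n k).left Z hZ).presheaf.stalk z) =
          ((1 : ℕ) : WithBot ℕ∞)) ∧
    ∃ (F₂ : Scheme.{0}) (υ : F₂ ⟶ (Literature.AlgebraicGeometry.Motives.projectiveSpace n k).left),
      IsBlowup υ (Scheme.IdealSheafData.vanishingIdeal
        (⟨Z, hZ⟩ : Closeds (Literature.AlgebraicGeometry.Motives.projectiveSpace n k).left)) ∧
      ∃ (F' : Scheme.{0}) (γ' : F' ⟶ F₂) (T' E' : Set F') (Es' Ns' : List (Set F')) (K' : Set F'),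
        (∀ R : (∀ G : Scheme.{0}, (G ⟶ F₂) → Set G → Set G → List (Set G) → List (Set G) → Set G → Prop),
          R F₂ (𝟙 F₂) (closure (υ ⁻¹' (Set.range ι \ Z))) (υ ⁻¹' Z) [] [] ∅ →
          TowerPtRegB₄ F₂ R →
          TowerPtRamB₄ F₂ R →
          TowerRoundBTriplePrime (Literature.AlgebraicGeometry.Motives.projectiveSpace n k).left F₂ υ Z hZ R →
          R F' γ' T' E' Es' Ns' K') ∧
        Literature.AlgebraicGeometry.Resolution.Scheme.IsRegular (redSub F' (closure T') isClosed_closure)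

/-- **(H-ν2) `NoseHypPointsFirstBTriplePrime`** — «POINTS FIRST, THEN AN UNOBSTRUCTED NOSE, THEN B‴»: K5′'s `hres` block (= the shape of every `IsoHyp*` blob, here
blob #20 `IsoHypDefTowerBTriplePrime` p628770 VERBATIM) with the `Reach` slot instantiated by `ReachPtNoseBTriplePrime`: the point-resolution motive `Q` holds at
`(ℙⁿ_k, 𝟙, range ι)`, is closed under the point step at a non-regular point of the reduced strict transform which is a regular point of the ambient AND under the nose move
hung off that point step; conclusion `Q F' ρ' T'` at a stage with regular reduced strict transform.  Customers: the (B2) branch after res-L1-w45b-nose-w2's point prefix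
✓ p646582, (B1)/C3b at the initial stage (NOSE WORD v1.1 §3).  [OURS · L1 W4.5b · named hypothesis, no mathematical content of its own] -/
def NoseHypPointsFirstBTriplePrime (k : Type) [Field k] [IsAlgClosed k] (n : ℕ) (H : AlgebraicGeometry.Scheme.{0})
    (ι : H ⟶ (Literature.AlgebraicGeometry.Motives.projectiveSpace n k).left) : Prop :=
  ∃ (F' : AlgebraicGeometry.Scheme.{0}) (ρ' : F' ⟶ (Literature.AlgebraicGeometry.Motives.projectiveSpace n k).left) (T' : Set F'), (∀ Q : (∀ F₁ : AlgebraicGeometry.Scheme.{0}, (F₁ ⟶ (Literature.AlgebraicGeometry.Motives.projectiveSpace n k).left) → Set F₁ → Prop), Q (Literature.AlgebraicGeometry.Motives.projectiveSpace n k).left (CategoryTheory.CategoryStruct.id (Literature.AlgebraicGeometry.Motives.projectiveSpace n k).left) (Set.range ι) → (∀ (F₁ F₂ : AlgebraicGeometry.Scheme.{0}) (ρ : F₁ ⟶ (Literature.AlgebraicGeometry.Motives.projectiveSpace n k).left) (T₁ : Set F₁) (x : ↥(AlgebraicGeometry.Scheme.IdealSheafData.vanishingIdeal (⟨closure T₁,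 isClosed_closure⟩ : TopologicalSpace.Closeds F₁)).subscheme) (υ : F₂ ⟶ F₁) (hx : IsClosed ({((AlgebraicGeometry.Scheme.IdealSheafData.vanishingIdeal (⟨closure T₁, isClosed_closure⟩ : TopologicalSpace.Closeds F₁)).subschemeι x : F₁)} : Set F₁)), Q F₁ ρ T₁ → ¬ IsRegularLocalRing ((AlgebraicGeometry.Scheme.IdealSheafData.vanishingIdeal (⟨closure T₁, isClosed_closure⟩ : TopologicalSpace.Closeds F₁)).subscheme.presheaf.stalk x) → IsRegularLocalRing (F₁.presheaf.stalk ((AlgebraicGeometry.Scheme.IdealSheafData.vanishingIdeal (⟨closure T₁, isClosed_closure⟩ : TopologicalSpace.Closeds F₁)).subschemeι x)) → Literature.AlgebraicGeometry.Resolution.IsBlowup υ (AlgebraicGeometry.Scheme.IdealSheafData.vanishingIdeal (⟨{((AlgebraicGeometry.Scheme.IdealSheafData.vanishingIdeal (⟨closure T₁, isClosed_closure⟩ : TopologicalSpace.Closeds F₁)).subschemeι x : F₁)}, hx⟩ : TopologicalSpace.Closeds F₁)) → Q F₂ (CategoryTheory.CategoryStruct.comp υ ρ) (closure (υ ⁻¹'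 (T₁ \ {((AlgebraicGeometry.Scheme.IdealSheafData.vanishingIdeal (⟨closure T₁, isClosed_closure⟩ : TopologicalSpace.Closeds F₁)).subschemeι x : F₁)}))) ∧ (∀ (F₉ : AlgebraicGeometry.Scheme.{0}) (β : F₉ ⟶ F₂) (T₉ : Set F₉), ReachPtNoseBTriplePrime F₁ F₂ υ ((AlgebraicGeometry.Scheme.IdealSheafData.vanishingIdeal (⟨closure T₁, isClosed_closure⟩ : TopologicalSpace.Closeds F₁)).subschemeι x) (closure (υ ⁻¹' (T₁ \ {((AlgebraicGeometry.Scheme.IdealSheafData.vanishingIdeal (⟨closure T₁, isClosed_closure⟩ : TopologicalSpace.Closeds F₁)).subschemeι x : F₁)}))) F₉ β T₉ → Q F₉ (CategoryTheory.CategoryStruct.comp (CategoryTheory.CategoryStruct.comp β υ) ρ) T₉)) → Q F' ρ' T') ∧ Literature.AlgebraicGeometry.Resolution.Scheme.IsRegular (AlgebraicGeometry.Scheme.IdealSheafData.vanishingIdeal (⟨closure T', isClosed_closure⟩ : TopologicalSpace.Closeds F')).subscheme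

end Summit.ResolutionOfSingularities.ResolutionOfSingularities.Cruxes.EquisingularLiftNat.Sections

end
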